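import Summits.KontsevichZagierPeriods.KontsevichZagierPeriods.Theorems.SoloBlindCycChart
import Summits.KontsevichZagierPeriods.KontsevichZagierPeriods.Theorems.SoloBlindOrderCells
import HarnessLib

/-!
# The odd-coordinate flip: the tangent cell `T_n` is the zig cell, a union of order cells

In even dimension `k = n + 2` (`n` even) the involution `F(s)ᵢ = sᵢ` (`i` even),
`F(s)ᵢ = (1 − sᵢ)/(1 + sᵢ)` (`i` odd) — in angles `uᵢ ↦ π/2 − uᵢ` on the odd coordinates —
preserves the angle weight (`W(F(s)ᵢ)·|F'ᵢ| = W(sᵢ)`) and turns each cyclic tangent condition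
`tᵢ + tᵢ₊₁ + tᵢtᵢ₊₁ < 1`, i.e. `(1 + tᵢ)(1 + tᵢ₊₁) < 2`, into an ORDER condition:
`sᵢ < sᵢ₊₁` for even `i`, `sᵢ₊₁ < sᵢ` for odd `i`.  Hence (rule (2), one move)

  `[Zig_n, w] ≡ [T_n, w]`,  `Zig_n = {s ∈ (0,1)ᵏ | odd coordinates are cyclic local maxima}`,

and `Zig_n` is, off the null tie set, the disjoint union of the order cells `Δ_σ` over the
**zig permutations** `σ` (`IsZigPerm`), so that in `Q`

  `[Zig_n, w] = A_n · [Δ_k, w]`,  `A_n = zigCount n = #{zig permutations}`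

(`A = 1, 4, 48, 1088, …` for `k = 2, 4, 6, 8, …`).
-/

noncomputable section

namespace Summit.KontsevichZagierPeriods.KontsevichZagierPeriods.Theorems

open Set MeasureTheory
open Literature.ModelTheory.ExponentialFields (IsSemialgebraic isSemialgebraic_setOf_eval_pos)
open MvPolynomial (aeval X C)
open Literature.NumberTheory.Transcendental
open Literature.NumberTheory.Transcendental.KZ

namespace SoloBlind

variable {n : ℕ}

/-! ## The one-variable flip `u ↦ (1-u)/(1+u)` -/

/-- The flip `φ(u) = (1 − u)/(1 + u)` (`tan(π/4 − θ/2)… `: complementary half-angle tangent). -/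
def flipF (u : ℝ) : ℝ := (1 - u) / (1 + u)

/-- `φ` is an involution on `u ≥ 0`. -/
theorem flipF_flipF {u : ℝ} (hu : 0 ≤ u) : flipF (flipF u) = u := by
  have h1 : (1 + u) ≠ 0 := by positivity
  have h2 : 1 + (1 - u) / (1 + u) = 2 / (1 + u) := by field_simp; ring
  have h3 : 1 - (1 - u) / (1 + u) = 2 * u / (1 + u) := by field_simp; ring
  rw [flipF, flipF, h2, h3]
  field_simp

/-- `φ` is positive on `[0,1)`. -/
theorem flipF_pos {u : ℝ} (h0 : 0 ≤ u) (h1 : u < 1) : 0 < flipF u :=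
  div_pos (by linarith) (by linarith)

/-- `φ < 1` on `u > 0`. -/
theorem flipF_lt_one {u : ℝ} (h0 : 0 < u) : flipF u < 1 := by
  rw [flipF, div_lt_one (by linarith)]
  linarith

/-- **The flip preserves the angle weight**: `W(φ(u))·2/(1+u)² = W(u)`. -/
theorem tW_flipF_mul {u : ℝ} (hu : 0 ≤ u) : tW (flipF u) * (2 / (1 + u) ^ 2) = tW u := by
  have h1 : (1 + u) ≠ 0 := by positivity
  unfold tW flipF
  field_simp
  ring

/-- The derivative of the flip: `φ'(u) = −2/(1+u)²`. -/
theorem hasDerivAt_flipF {u : ℝ} (hu : 1 + u ≠ 0) : HasDerivAt flipF (-(2 / (1 + u) ^ 2)) u := by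
  have h1 : HasDerivAt (fun x : ℝ => 1 - x) (-1) u := (hasDerivAt_id' u).const_sub 1
  have h2 : HasDerivAt (fun x : ℝ => 1 + x) 1 u := by
    simpa using (hasDerivAt_id' u).const_add 1
  refine (h1.div h2 hu).congr_deriv ?_
  field_simp
  ring

/-- A cyclic tangent condition with a flipped RIGHT entry is an order condition. -/
theorem cyc_cond_flip_right {a s : ℝ} (hs : 0 < 1 + s) :
    a + flipF s + a * flipF s < 1 ↔ a < s := by
  rw [show a + flipF s + a * flipF s = 2 * (1 + a) / (1 + s) - 1 by
    unfold flipF; field_simp; ring, sub_lt_iff_lt_add, div_lt_iff₀ hs]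
  constructor <;> intro h <;> linarith

/-- A cyclic tangent condition with a flipped LEFT entry is an order condition. -/
theorem cyc_cond_flip_left {s b : ℝ} (hs : 0 < 1 + s) :
    flipF s + b + flipF s * b < 1 ↔ b < s := by
  rw [show flipF s + b + flipF s * b = b + flipF s + b * flipF s by ring]
  exact cyc_cond_flip_right hs

/-! ## Parity around an even cycle -/

/-- For even `n`, parity alternates all the way around `ℤ/(n+2)`. -/
theorem even_val_add_one (hn : Even n) (i : Fin (n + 2)) :
    Even (i + 1 : Fin (n + 2)).val ↔ ¬ Even i.val := by
  rw [Fin.val_add_one]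
  split_ifs with h
  · rw [h, Fin.val_last]
    simpa [Nat.even_add_one] using hn
  · exact Nat.even_add_one

/-! ## The flip chart and the zig cell -/

/-- **The flip chart** `F(s)ᵢ = sᵢ` for even `i`, `(1 − sᵢ)/(1 + sᵢ)` for odd `i`. -/
def cycFlip (s : Fin (n + 2) → ℝ) : Fin (n + 2) → ℝ :=
  fun i => if Even i.val then s i else flipF (s i)

/-- Even coordinates are kept. -/
theorem cycFlip_of_even {s : Fin (n + 2) → ℝ} {i : Fin (n + 2)} (h : Even i.val) :
    cycFlip s i = s i := if_pos h

/-- Odd coordinates are flipped. -/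
theorem cycFlip_of_odd {s : Fin (n + 2) → ℝ} {i : Fin (n + 2)} (h : ¬ Even i.val) :
    cycFlip s i = flipF (s i) := if_neg h

/-- `F` is an involution on nonnegative tuples. -/
theorem cycFlip_cycFlip {s : Fin (n + 2) → ℝ} (hs : ∀ i, 0 ≤ s i) : cycFlip (cycFlip s) = s := by
  funext i
  by_cases h : Even i.val
  · rw [cycFlip_of_even h, cycFlip_of_even h]
  · rw [cycFlip_of_odd h, cycFlip_of_odd h, flipF_flipF (hs i)]

/-- **The zig cell**: points of `(0,1)ᵏ` whose odd coordinates are cyclic local maxima. -/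
def zigCellK (n : ℕ) : Set (Fin (n + 2) → ℝ) :=
  {s | ∀ i, (0 < s i ∧ s i < 1) ∧ (Even i.val → s i < s (i + 1)) ∧
    (¬ Even i.val → s (i + 1) < s i)}

/-- The zig cell lies in the box. -/
theorem zigCellK_subset_kzOpenBox : zigCellK n ⊆ kzOpenBox (n + 2) := fun _ hs i => (hs i).1

/-- The zig cell is `ℚ`-semialgebraic. -/
theorem isSemialgebraic_zigCellK (n : ℕ) : IsSemialgebraic ℚ (zigCellK n) := by
  have h : zigCellK n = ⋂ i ∈ (Finset.univ : Finset (Fin (n + 2))),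
      (({s : Fin (n + 2) → ℝ | 0 < aeval s (X i : MvPolynomial (Fin (n + 2)) ℚ)} ∩
        {s | 0 < aeval s (1 - X i : MvPolynomial (Fin (n + 2)) ℚ)}) ∩
        if Even i.val then {s | 0 < aeval s (X (i + 1) - X i : MvPolynomial (Fin (n + 2)) ℚ)}
        else {s | 0 < aeval s (X i - X (i + 1) : MvPolynomial (Fin (n + 2)) ℚ)}) := by
    ext s
    simp only [zigCellK, mem_setOf_eq, Finset.mem_univ, iInter_true, mem_iInter, mem_inter_iff]
    refine forall_congr' fun i => ?_
    by_cases he : Even i.val <;> simp [he, sub_pos]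
  rw [h]
  refine IsSemialgebraic.biInter _ _ fun i _ => IsSemialgebraic.inter
    ((isSemialgebraic_setOf_eval_pos _).inter (isSemialgebraic_setOf_eval_pos _)) ?_
  split_ifs <;> exact isSemialgebraic_setOf_eval_pos _

/-- The zig cell is measurable. -/
theorem measurableSet_zigCellK (n : ℕ) : MeasurableSet (zigCellK n) :=
  IsSemialgebraic.measurableSet_holds (isSemialgebraic_zigCellK n)

/-- **`F(Zig_n) ⊆ T_n`** (`n` even). -/
theorem cycFlip_mem_cycCell (hn : Even n) {s : Fin (n + 2) → ℝ} (hs : s ∈ zigCellK n) :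
    cycFlip s ∈ cycCell n := by
  intro i
  have hpar := even_val_add_one hn i
  by_cases he : Even i.val
  · have ho : ¬ Even (i + 1 : Fin (n + 2)).val := fun h => hpar.mp h he
    rw [cycFlip_of_even he, cycFlip_of_odd ho,
      cyc_cond_flip_right (by linarith [(hs (i + 1)).1.1] : (0 : ℝ) < 1 + s (i + 1))]
    exact ⟨(hs i).1.1, (hs i).2.1 he⟩
  · have heo : Even (i + 1 : Fin (n + 2)).val := hpar.mpr he
    rw [cycFlip_of_odd he, cycFlip_of_even heo,
      cyc_cond_flip_left (by linarith [(hs i).1.1] : (0 : ℝ) < 1 + s i)]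
    exact ⟨flipF_pos (hs i).1.1.le (hs i).1.2, (hs i).2.2 he⟩

/-- **`F(T_n) ⊆ Zig_n`** (`n` even). -/
theorem cycFlip_mem_zigCellK (hn : Even n) {t : Fin (n + 2) → ℝ} (ht : t ∈ cycCell n) :
    cycFlip t ∈ zigCellK n := by
  intro i
  have hpar := even_val_add_one hn i
  have h0 := (ht i).1
  have h1 := lt_one_of_mem_cycCell ht i
  have h0' := (ht (i + 1)).1
  have h1' := lt_one_of_mem_cycCell ht (i + 1)
  by_cases he : Even i.val
  · have ho : ¬ Even (i + 1 : Fin (n + 2)).val := fun h => hpar.mp h he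
    refine ⟨by rw [cycFlip_of_even he]; exact ⟨h0, h1⟩, fun _ => ?_, fun h => (h he).elim⟩
    rw [cycFlip_of_even he, cycFlip_of_odd ho, ← cyc_cond_flip_right
      (by linarith [flipF_pos h0'.le h1'] : (0 : ℝ) < 1 + flipF (t (i + 1))), flipF_flipF h0'.le]
    exact (ht i).2
  · have heo : Even (i + 1 : Fin (n + 2)).val := hpar.mpr he
    refine ⟨by rw [cycFlip_of_odd he]; exact ⟨flipF_pos h0.le h1, flipF_lt_one h0⟩,
      fun h => (he h).elim, fun _ => ?_⟩
    rw [cycFlip_of_odd he, cycFlip_of_even heo, ← cyc_cond_flip_left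
      (by linarith [flipF_pos h0.le h1] : (0 : ℝ) < 1 + flipF (t i)), flipF_flipF h0.le]
    exact (ht i).2

/-- **`F(Zig_n) = T_n`.** -/
theorem image_cycFlip (hn : Even n) : cycFlip '' zigCellK n = cycCell n := by
  refine Subset.antisymm (image_subset_iff.mpr fun s hs => cycFlip_mem_cycCell hn hs)
    fun t ht => ⟨cycFlip t, cycFlip_mem_zigCellK hn ht, cycFlip_cycFlip fun i => (ht i).1.le⟩

/-- `F` is injective on the zig cell. -/
theorem injOn_cycFlip : InjOn (cycFlip (n := n)) (zigCellK n) := fun s hs s' hs' h =>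
  calc s = cycFlip (cycFlip s) := (cycFlip_cycFlip fun i => (hs i).1.1.le).symm
    _ = cycFlip (cycFlip s') := by rw [h]
    _ = s' := cycFlip_cycFlip fun i => (hs' i).1.1.le

/-! ## Derivative and Jacobian of the flip chart -/

/-- Diagonal entries of `DF`: `1` (even `i`) or `φ'(sᵢ) = −2/(1+sᵢ)²` (odd `i`). -/
def flipD (s : Fin (n + 2) → ℝ) (i : Fin (n + 2)) : ℝ :=
  if Even i.val then 1 else -(2 / (1 + s i) ^ 2)

/-- The derivative `DF(s) = diag(flipD s)`. -/
def flipDeriv (s : Fin (n + 2) → ℝ) : (Fin (n + 2) → ℝ) →L[ℝ] (Fin (n + 2) → ℝ) :=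
  ContinuousLinearMap.pi fun i =>
    flipD s i • ContinuousLinearMap.proj (R := ℝ) (φ := fun _ : Fin (n + 2) => ℝ) i

/-- `F` is differentiable with derivative `flipDeriv` at tuples with `1 + sᵢ ≠ 0`. -/
theorem hasFDerivAt_cycFlip {s : Fin (n + 2) → ℝ} (hs : ∀ i, 1 + s i ≠ 0) :
    HasFDerivAt cycFlip (flipDeriv s) s := by
  rw [hasFDerivAt_pi']
  intro i
  have hrow : (ContinuousLinearMap.proj (R := ℝ) (φ := fun _ : Fin (n + 2) => ℝ) i).comp
      (flipDeriv s) = flipD s i • ContinuousLinearMap.proj (R := ℝ) (φ := fun _ => ℝ) i :=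
    ContinuousLinearMap.ext fun w => by simp [flipDeriv]
  rw [hrow]
  by_cases he : Even i.val
  · simp only [cycFlip, flipD, he, if_true, one_smul]
    exact hasFDerivAt_apply i s
  · simp only [cycFlip, flipD, he, if_false]
    exact HasDerivAt.comp_hasFDerivAt (h₂ := flipF) (f := fun y : Fin (n + 2) → ℝ => y i) s
      (hasDerivAt_flipF (hs i)) (hasFDerivAt_apply i s)

/-- The matrix of `DF(s)` is diagonal. -/
theorem toMatrix_flipDeriv (s : Fin (n + 2) → ℝ) :
    LinearMap.toMatrix' ((flipDeriv s : (Fin (n + 2) → ℝ) →L[ℝ] (Fin (n + 2) → ℝ)) :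
      (Fin (n + 2) → ℝ) →ₗ[ℝ] (Fin (n + 2) → ℝ)) = Matrix.diagonal (flipD s) := by
  ext i j
  rw [LinearMap.toMatrix'_apply, ContinuousLinearMap.coe_coe, Matrix.diagonal_apply]
  by_cases h : i = j
  · subst h; simp [flipDeriv]
  · simp [flipDeriv, h]

/-- The Jacobian factor `|det DF(s)| = ∏ᵢ |flipD s i|`. -/
theorem abs_det_flipDeriv (s : Fin (n + 2) → ℝ) : |(flipDeriv s).det| = ∏ i, |flipD s i| := by
  rw [ContinuousLinearMap.det, ← LinearMap.det_toMatrix', toMatrix_flipDeriv, Matrix.det_diagonal,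
    Finset.abs_prod]

/-- **Weight preservation, coordinatewise**: `W(F(s)ᵢ)·|flipD s i| = W(sᵢ)`. -/
theorem tW_cycFlip_mul {s : Fin (n + 2) → ℝ} (hs : ∀ i, 0 ≤ s i) (i : Fin (n + 2)) :
    tW (cycFlip s i) * |flipD s i| = tW (s i) := by
  by_cases he : Even i.val
  · rw [cycFlip_of_even he, flipD, if_pos he, abs_one, mul_one]
  · have h1 : 0 < 1 + s i := by linarith [hs i]
    rw [cycFlip_of_odd he, flipD, if_neg he, abs_neg, abs_of_pos (div_pos two_pos (pow_pos h1 2))]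
    exact tW_flipF_mul (hs i)

/-- **Weight preservation**: `w(F s)·|det DF(s)| = w(s)`. -/
theorem angWeight_cycFlip_mul {s : Fin (n + 2) → ℝ} (hs : ∀ i, 0 ≤ s i) :
    angWeight (n + 2) (cycFlip s) * ∏ i, |flipD s i| = angWeight (n + 2) s := by
  rw [angWeight_eq, angWeight_eq, ← Finset.prod_mul_distrib]
  exact Finset.prod_congr rfl fun i _ => tW_cycFlip_mul hs i

/-- `F` is a `ℚ`-semialgebraic (rational) map on the zig cell. -/
theorem isSemialgebraicMapOn_cycFlip : IsSemialgebraicMapOn ℚ (zigCellK n) cycFlip := by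
  refine IsSemialgebraicMapOn.of_forall (isSemialgebraic_zigCellK n) fun i => ?_
  by_cases he : Even i.val
  · exact (isSemialgebraicFunOn_aeval (isSemialgebraic_zigCellK n) (X i)).congr
      fun s _ => by simp [cycFlip_of_even he]
  · refine (isSemialgebraicFunOn_aeval_div_aeval (isSemialgebraic_zigCellK n) (1 - X i) (1 + X i)
      fun s hs => ?_).congr fun s _ => by simp [cycFlip_of_odd he, flipF]
    have h : (0 : ℝ) < 1 + s i := by linarith [(hs i).1.1]
    simpa using h.ne'

/-! ## The move `[Zig_n, w] ≡ [T_n, w]` -/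

/-- `[Zig_n, w]`. -/
def zigPieceK (n : ℕ) : IntegralRep (n + 2) :=
  angPiece (zigCellK n) (isSemialgebraic_zigCellK n) zigCellK_subset_kzOpenBox

/-- `[T_n, w]`: the cyclic tangent cell with the angle weight. -/
def cycPiece (n : ℕ) : IntegralRep (n + 2) :=
  angPiece (cycCell n) (isSemialgebraic_cycCell n) cycCell_subset_kzOpenBox

/-- **Rule (2) along the flip chart: `[Zig_n, w] ≡ [T_n, w]`** (`n` even). -/
theorem zigPieceK_equiv_cycPiece (hn : Even n) : Equivalent (zigPieceK n) (cycPiece n) :=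
  equivalent_of_chart (f := angWeight (n + 2)) (g := angWeight (n + 2))
    (J := fun s => ∏ i, |flipD s i|) isSemialgebraicMapOn_cycFlip
    (fun s hs => hasFDerivAt_cycFlip fun i => by linarith [(hs i).1.1])
    injOn_cycFlip (image_cycFlip hn) (fun s _ => abs_det_flipDeriv s)
    (fun s hs => (angWeight_cycFlip_mul fun i => (hs i).1.1.le).symm) rfl
    (fun s _ => by rw [zigPieceK, angPiece_integrand]) rfl
    fun t _ => by rw [cycPiece, angPiece_integrand]

/-! ## The zig cell is a union of order cells -/

/-- **Zig permutations**: `σ` lists the coordinates in decreasing order (`Δ_σ = {t ∘ σ ∈ Δ}`)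
and every odd coordinate comes BEFORE (is larger than) both of its cyclic neighbours. -/
def IsZigPerm (σ : Equiv.Perm (Fin (n + 2))) : Prop :=
  ∀ i : Fin (n + 2), (Even i.val → σ.symm (i + 1) < σ.symm i) ∧
    (¬ Even i.val → σ.symm i < σ.symm (i + 1))

/-- Being a zig permutation is decidable (finitely many comparisons). -/
instance : DecidablePred (IsZigPerm (n := n)) := fun σ => by
  unfold IsZigPerm; infer_instance

/-- The finite set of zig permutations. -/
def zigSet (n : ℕ) : Finset (Equiv.Perm (Fin (n + 2))) := Finset.univ.filter IsZigPerm

/-- **`A_n`**, the number of zig permutations of `Fin (n+2)`. -/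
def zigCount (n : ℕ) : ℕ := (zigSet n).card

/-- In the order cell `Δ_σ`, comparisons of coordinates are comparisons of positions. -/
theorem lt_iff_of_mem_orderCellK {σ : Equiv.Perm (Fin (n + 2))} {t : Fin (n + 2) → ℝ}
    (ht : t ∈ (orderCellK σ).domain) (i j : Fin (n + 2)) : t i < t j ↔ σ.symm j < σ.symm i := by
  have h : StrictAnti (fun p => t (σ p)) := (mem_orderCellK_domain.mp ht).2.2
  simpa using StrictAnti.lt_iff_gt (hf := h) (a := σ.symm i) (b := σ.symm j)

/-- Order cells of zig permutations lie in the zig cell. -/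
theorem orderCellK_subset_zigCellK {σ : Equiv.Perm (Fin (n + 2))} (hσ : IsZigPerm σ) :
    (orderCellK σ).domain ⊆ zigCellK n := fun _ ht i =>
  ⟨orderCellK_domain_subset σ ht i, fun he => (lt_iff_of_mem_orderCellK ht _ _).mpr ((hσ i).1 he),
    fun ho => (lt_iff_of_mem_orderCellK ht _ _).mpr ((hσ i).2 ho)⟩

/-- An order cell meeting the zig cell belongs to a zig permutation. -/
theorem isZigPerm_of_mem {σ : Equiv.Perm (Fin (n + 2))} {t : Fin (n + 2) → ℝ}
    (hz : t ∈ zigCellK n) (ht : t ∈ (orderCellK σ).domain) : IsZigPerm σ := fun i =>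
  ⟨fun he => (lt_iff_of_mem_orderCellK ht _ _).mp ((hz i).2.1 he),
    fun ho => (lt_iff_of_mem_orderCellK ht _ _).mp ((hz i).2.2 ho)⟩

/-- **Dissection (rule (1))**: `[Zig_n, w] − Σ_{σ zig} [Δ_σ, w] ∈ relations`. -/
theorem zigPieceK_sub_sum (n : ℕ) :
    of (zigPieceK n) - ∑ σ ∈ zigSet n, of (orderCellK σ) ∈ relations := by
  refine of_sub_sum_of_mem_relations (zigSet n) (zigPieceK n) orderCellK
    (fun σ hσ => measure_mono_null (fun t ht => (ht.2
      (orderCellK_subset_zigCellK (Finset.mem_filter.mp hσ).2 ht.1)).elim) measure_empty)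
    (fun σ _ t _ => by rw [orderCellK_integrand, zigPieceK, angPiece_integrand]) ?_
    (fun σ _ τ _ hστ => show volume ((orderCellK σ).domain ∩ (orderCellK τ).domain) = 0 by
      rw [orderCellK_domain_disjoint hστ, measure_empty])
  exact volume_diff_orderCells_eq_zero zigCellK_subset_kzOpenBox _
    fun t ht σ hσ => Finset.mem_filter.mpr ⟨Finset.mem_univ σ, isZigPerm_of_mem ht hσ⟩

/-- **`[Zig_n, w] = A_n · [Δ_k, w]` in `Q`.** -/
theorem mkQ_zigPieceK (n : ℕ) :
    mkQ (of (zigPieceK n)) = zigCount n • mkQ (of (simplexPieceK (n + 2))) := by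
  rw [mkQ_eq_mkQ_iff.mpr (zigPieceK_sub_sum n), mkQ_sum_orderCellK]
  rfl

/-- **`[T_n, w] = A_n · [Δ_k, w]` in `Q`** (`n` even). -/
theorem mkQ_cycPiece (hn : Even n) :
    mkQ (of (cycPiece n)) = zigCount n • mkQ (of (simplexPieceK (n + 2))) := by
  rw [← mkQ_eq_mkQ_iff.mpr (zigPieceK_equiv_cycPiece hn), mkQ_zigPieceK]

/-- `A_0 = 1` (`k = 2`). -/
theorem zigCount_zero : zigCount 0 = 1 := by decide

/-- `A_2 = 4` (`k = 4`). -/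
theorem zigCount_two : zigCount 2 = 4 := by decide

/-- `A_4 = 48` (`k = 6`). -/
theorem zigCount_four : zigCount 4 = 48 := by decide

end SoloBlind

end Summit.KontsevichZagierPeriods.KontsevichZagierPeriods.Theorems
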